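import Mathlib.RepresentationTheory.Homological.GroupCohomology.Functoriality
import Mathlib.Topology.Algebra.Localization
import Mathlib.Topology.Algebra.Ring.Basic
import Mathlib.Topology.Algebra.Ring.Ideal
import Mathlib.RingTheory.Localization.AtPrime.Basic
import Mathlib.NumberTheory.NumberField.CMField
import Mathlib.LinearAlgebra.Dual.Defs
import Literature.NumberTheory.Automorphic.GLnAdelicStructureProofs
import Literature.NumberTheory.Automorphic.HeckeDoubleCosetOperators
import Literature.NumberTheory.GaloisRepresentations.GaloisRep
import HarnessLib

/-!
# The completed-cohomology ("big") Hecke algebra `𝕋(K^p)` of `GL_n` over a number field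

Topic `NumberTheory/Automorphic`; namespace `Literature.NumberTheory.Automorphic`, grouping
sub-namespace `BigHeckeGLn` (the object); the headline type is
`Literature.NumberTheory.Automorphic.CompletedCohomologyHeckeAlgebraGLn 𝒰`.

For a number field `K`, `n ≥ 0`, a prime `p` and an `S`-good level datum `𝒰 : TameLevel n K p`
(an open compact `U = U_S · ∏_{v ∉ S} GL_n(𝒪_v) ≤ GL_n(𝒪̂_K)`, `S ∋` all `v ∣ p`, Scholze's
`K = K_S K^S`), we CONSTRUCT — no axioms, no `sorry`, no existence smuggled —

* the cohomology `H^i(X_U, k)` of Scholze's (stacky) arithmetic quotient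
  `X_U = GL_n(K)\[(GL_n(K ⊗ ℝ)/ℝ_{>0}K_∞) × GL_n(𝔸_K^∞)/U]` [cite: Scholze2015, §V.4, before
  Thm. V.4.1] as the GROUP COHOMOLOGY (Mathlib `groupCohomology`) of `Γ = GL_n(K)` with
  coefficients in `Fun(GL_n(𝔸_K^∞)/U, k)`, realised as the `k`-dual of the permutation module
  `k[GL_n(𝔸_K^∞)/U]` (`levelModule`, `levelRep`, `levelCohomology`): the symmetric space
  `GL_n(K ⊗ ℝ)/ℝ_{>0}K_∞` is contractible, so equivariant cohomology of `X_U` is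
  `H^i(Γ, Fun(GL_n(𝔸_K^∞)/U, k)) = ⊕_j H^i(Γ_j, k)` (Shapiro; `Γ_j = Γ ∩ g_j U g_j⁻¹`);
* the Hecke operators `[U g U]` on it (`heckeOnCohomology`): functoriality of `groupCohomology`
  applied to the transpose (`LinearMap.dualMap`) of the tree's `G`-equivariant double-coset
  operator `heckeAlgebra.doubleCosetOperator U g ∈ End_G(k[G/U])` — on functions this is
  `(T f)(xU) = ∑_{yU ⊆ UgU} f(xyU)`, the convention of `heckeOperator`/`heckeTAt`
  (`GLnAdelicStructure`) and of [cite: GeeNewton2020, §2.1.1];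
* the `p`-power tower `U_r = U ∩ {g | g_v ≡ 1 mod ϖ_v^r, v ∣ p}` (`TameLevel.tower`, cut out by the
  principal congruence subgroups `valuedCongruenceSubgroup (Fin n) |ϖ_v|^r` of `GLnAdelicStructure`;
  open and compact, hence a Hecke pair), the spherical Hecke elements
  `t_{v,i} = diag(ϖ_v,…,ϖ_v,1,…,1)` (`heckeElement`), and
* the **big Hecke algebra** `𝕋(K^p) = CompletedCohomologyHeckeAlgebraGLn 𝒰`: the closure of the
  subring generated by the `T_{v,i}` (`v ∉ S`, all `i`) and the operators of `t_{v,n}⁻¹` inside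
  the product, over all `(r, s, i)`, of the (discrete) rings `End(H^i(X_{U_r}, ℤ/p^s))` — i.e. the
  inverse limit over finite sets of indices of the images of the abstract spherical Hecke algebra
  `𝕋^S`, which is the cohomological big Hecke algebra of [cite: GeeNewton2020, §2.1.3,
  Def. 2.1.5 and Rem. 2.1.7] (there for `PGL_n` and with endomorphisms of complexes; the map to
  our cohomological version is surjective with (pro-)nilpotent kernel, loc. cit. Rem. 2.1.6),
  of [cite: Scholze2015, Rem. V.4.5] at finite level, the "suitably completed Hecke algebra `𝕋`"
  of [cite: CalegariEmerton2011, §2] acting on the completed cohomology `H̃^•` of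
  [cite: Emerton2006, §2.2, Def. 2.2.9] through its spherical Hecke algebra `ℋ(K^p)^{sph}`
  (loc. cit. §2.3). It is a closed subring of a product of discrete rings, hence a Hausdorff
  topological ring.

On top of this we provide the VOCABULARY the Langlands routes asked for, as predicates /
hypothesis structures (existence is NOT built in; it is recorded separately as named facts):

* `heckeFrobPoly n q a = X^n − a₁X^{n−1} + … + (−1)^i q^{i(i−1)/2} a_i X^{n−i} + …`, the
  Hecke–Frobenius polynomial in the normalisation of [cite: GeeNewton2020, §3.3, Conj. 3.3.2]
  (= the monic form of [cite: HansenUniversalEigenvarieties2017, Def. 1.2.1]);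
  `IsAssociatedFamily`, `TameLevel.IsAssociated x ρ`: "`ρ` and the eigensystem `x` are
  associated": `ρ` unramified at `v ∉ S` with `charpoly ρ(Frob_v) = x(P_v)`;
* `TameLevel.IsPadicallyAutomorphic 𝒰 ρ` ("`ρ` is `𝔭`-adically automorphic / pro-automorphic
  of tame level `𝒰`"): `ρ` is associated with a CONTINUOUS `A`-valued point of `𝕋(K^p)`
  (Hansen's Def. 1.2.1 with the completed-cohomology Hecke algebra in place of the eigenvariety;
  Emerton's "pro-modular"); `IsPointOver 𝔪 x` (points of `Spf 𝕋(K^p)_𝔪`);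
* `IsResidualRepAt 𝔪 ψ ρ̄` (`ρ̄_𝔪`), `IsNonEisenstein 𝔪` (`ρ̄_𝔪` absolutely irreducible);
* commutativity of `𝕋(K^p)` as the named fact `heckeGenerators_commute` [cite: GeeNewton2020,
  §2.1.1] [cite: Cartier1979, §IV.1], from which `commRing`, the localisation
  `𝕋(K^p)_𝔪 = TameLevel.Localized 𝒰 h 𝔪` (Mathlib `Localization.AtPrime` with its ring topology,
  `Mathlib.Topology.Algebra.Localization`) and the hypothesis structure `BigGaloisRepAt`
  (`ρ_𝔪 : Γ_K → GL_n(𝕋(K^p)_𝔪)` continuous with `charpoly ρ_𝔪(Frob_v) = P_v`, the datum of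
  [cite: GeeNewton2020, Conj. 3.3.2 (2)], cf. [cite: CalegariGeraghty2017, Conj. A (arXiv version §4.3)]);
* the finite-level Hecke algebras `𝕋(U_r, s, i)` (`levelHeckeSubring`, `levelHeckeT`) in which the
  EXISTENCE THEOREMS are stated. Those two named facts (for `K` totally real, e.g. `K = ℚ`; both
  predicates in the level datum `𝒰`) — `TameLevel.residualRep_exists` (Scholze,
  [cite: Scholze2015, Thm. V.4.1, Cor. V.4.3], at every finite level `(r,s,i)`) and
  `TameLevel.bigGaloisRep_modNilpotent_exists` ([cite: GeeNewton2020, Rem. 3.3.3]: Scholze, modulo a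
  nilpotent ideal) — live, unchanged, in the LEAF module
  `Literature.NumberTheory.Automorphic.CompletedCohomologyHeckeAlgebraGLnFacts` (moved out
  2026-08-17 so that this vocabulary module carries no unproved named fact; nothing here uses
  them). The existence of `ρ_𝔪` on the nose, [cite: GeeNewton2020, Conj. 3.3.2 (2)], is an OPEN
  conjecture and is deliberately not declared in `Literature/` (conjectures are obligations of the
  routes that use them, filed under `Summits/…/Theorems`); its Lean shape is
  `Nonempty (BigGaloisRepAt 𝒰 h 𝔪)` for `𝔪` non-Eisenstein maximal;
* the non-vacuity witness `TameLevel.full n K p` (full level `GL_n(𝒪̂_K)`, `S = {v ∣ p}`), built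
  from the PROVED compactness `isCompact_glFiniteIntegralLevel_holds`.

## Import discipline (read before "deduplicating")

This is a VOCABULARY file: routes type `p`-adic occurrence with `TameLevel.IsPadicallyAutomorphic`,
so its import cone is kept to `GLnAdelicStructureProofs` + `HeckeDoubleCosetOperators` + `GaloisRep`
(about twenty `Literature` modules, no unproved named fact outside the cone of the Langlands
statement). In particular it does NOT import `GLnCuspidalSpectrumProofs` (the `L²`/cusp-form cone,
150 modules): the principal congruence subgroup `localCongruenceSubgroup n K v r` of that file is
written here by its one-line definition `valuedCongruenceSubgroup (Fin n) (WithZero.exp (-r))`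
(so the two agree definitionally and statements over either elaborate against `TameLevel.tower`),
and the openness of these subgroups is re-derived inside `TameLevel.isOpen_tower` from Mathlib's
`Valued.isOpen_closedBall`. Consumers needing the neighbourhood-basis lemmas
(`exists_localCongruenceSubgroup_subset`, …) import `GLnCuspidalSpectrumProofs` themselves
(`CompletedCohomologyGLHecke`, `CompletedCohomologyActionGL`).

## Conventions (read before using)

* **Frobenius.** `IsAssociatedFamily` uses the tree's `FramedGaloisRep.HasFrobCharpolyAt`, i.e.
  ARITHMETIC Frobenius and the monic characteristic polynomial `det(X − ρ(Frob_v))`. Sources using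
  geometric Frobenius state the same identity for the dual `ρ^∨`; Scholze's `P_v` [cite:
  Scholze2015, §V.4] is Satake-normalised (`C`-algebraic) and differs from ours by the twist
  `X ↦ q_v X`, i.e. by a power of the cyclotomic character. Existence statements below are
  insensitive to these dictionary changes (dual / twist of a continuous semisimple representation).
* **`q_v`** is `Ideal.absNorm v.asIdeal`; the uniformiser `ϖ_v` in `t_{v,i}` is a fixed choice
  (`uniformizerAt`, from Mathlib's `valuation_exists_uniformizer`); the double coset
  `U t_{v,i} U`, hence `T_{v,i}`, does not depend on it for `v ∉ S` (hyperspecial), a lemma left to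
  users (`heckeAlgebra.doubleCosetOperator_mul_mul_eq`).
* **`X_U` vs `X̃_U`.** We use `K_∞ = O(n)`-type maximal compact subgroups (Scholze's `X_K`); the
  `2^{r₁}`-fold cover `X̃_K` (`K_∞°`) of [cite: Scholze2015, proof of Cor. V.4.2] and of
  [cite: CalegariEmerton2011, §2] differs by sign-character twists and is not formalised here.
* **Junk values.** `TameLevel.heckeT 𝒰 v i = 0` for `v ∈ S` (only `v ∉ S` is meaningful);
  `heckeElement n K v i = t_{v,n}` for `i ≥ n`.
* `R = 𝕋_𝔪`-type statements are sensitive to nilpotents (our `𝕋` is the reduced-direction,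
  cohomological version; see above); eigensystems, points in reduced rings and residual
  representations are not.

## Not here (deliberately)

Completed cohomology `H̃^i` itself as a `GL_n(K_p)`-module (item `defn-CompletedCohomology`),
Emerton's eigenvariety / Hansen's `𝒳_{K^p}`, Chenevier determinants (pseudorepresentations) —
`BigGaloisRepAt` is stated for non-Eisenstein `𝔪`, where determinants are representations —,
the comparison with singular cohomology of the manifold `X_U` for neat `U`, the identification of
`T_{v,i}` with Satake parameters of classical `π` (`HasSatakeParameterAt`), local–global
compatibility at `v ∈ S` and at `p`, and any `R = 𝕋` statement.
-/

noncomputable section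

open scoped NumberField
open IsDedekindDomain CategoryTheory

namespace Literature.NumberTheory.Automorphic

namespace BigHeckeGLn

variable (n : ℕ) (K : Type) [Field K] [NumberField K]

/-! ### The finite-adelic group, local components, Hecke elements -/

/-- `GL_n(𝔸_K^∞)`, the finite-adelic points of `GL_n` over the number field `K`
(`IsDedekindDomain.FiniteAdeleRing`). [folklore] -/
abbrev FiniteAdelicGL : Type := GL (Fin n) (FiniteAdeleRing (𝓞 K) K)

/-- The diagonal embedding `Γ = GL_n(K) →* GL_n(𝔸_K^∞)` (Mathlib `algebraMap K 𝔸_K^∞`,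
entrywise). [folklore] -/
def globalEmbedding : GL (Fin n) K →* FiniteAdelicGL n K :=
  Matrix.GeneralLinearGroup.map (algebraMap K (FiniteAdeleRing (𝓞 K) K))

/-- The `v`-component `GL_n(𝔸_K^∞) →* GL_n(K_v)` (`AdelicGroupData.finiteAdeleEval`, entrywise).
[folklore] -/
def localComponent (v : HeightOneSpectrum (𝓞 K)) :
    FiniteAdelicGL n K →* GL (Fin n) (v.adicCompletion K) :=
  Matrix.GeneralLinearGroup.map (AdelicGroupData.finiteAdeleEval K v)

/-- `localComponent` is continuous. [folklore] -/
theorem continuous_localComponent (v : HeightOneSpectrum (𝓞 K)) :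
    Continuous (localComponent n K v) :=
  (AdelicGroupData.continuous_finiteAdeleEval K v).generalLinearGroup_map

/-- The local embedding `GL_n(K_v) →* GL_n(𝔸_K^∞)`, `g ↦ (g at v, 1 elsewhere)` (finite part of
the tree's `GLn.ofLocal`). [folklore] -/
def ofLocal (v : HeightOneSpectrum (𝓞 K)) : GL (Fin n) (v.adicCompletion K) →* FiniteAdelicGL n K :=
  (GLn.sndHom n K).comp (GLn.ofLocal n K v)

variable {K} in
/-- A fixed uniformiser `ϖ_v ∈ K_vˣ` at the finite place `v`: the image of an element of `K` of
`v`-adic valuation `exp(-1)` (Mathlib `valuation_exists_uniformizer`). [folklore] -/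
def uniformizerAt (v : HeightOneSpectrum (𝓞 K)) : (v.adicCompletion K)ˣ :=
  Units.mk0 (algebraMap K (v.adicCompletion K) (Classical.choose (v.valuation_exists_uniformizer K)))
    ((map_ne_zero _).2 fun h => by
      have := Classical.choose_spec (v.valuation_exists_uniformizer K)
      rw [h, map_zero] at this
      exact WithZero.coe_ne_zero this.symm)

/-- The **Hecke element** `t_{v,i} = diag(ϖ_v,…,ϖ_v,1,…,1) ∈ GL_n(𝔸_K^∞)` (`i` copies of the local
idele of `ϖ_v`), whose `GL_n(𝒪_v)`-double coset is `T_{v,i}` [cite: GeeNewton2020, §2.1.1]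
(there `α_{v,i}`); finite-adelic form of the tree's `heckeDiagAt`. -/
def heckeElement (v : HeightOneSpectrum (𝓞 K)) (i : ℕ) : FiniteAdelicGL n K :=
  glDiagonal n (FiniteAdeleRing (𝓞 K) K) fun k =>
    if k.val < i then uniformizerIdele K v (uniformizerAt v) else 1

variable {n K}

/-! ### Cohomology of the arithmetic quotients `X_U` and its Hecke operators -/

section Level

variable (U : Subgroup (FiniteAdelicGL n K)) (k : Type) [CommRing k]

/-- The coefficient module `Fun(GL_n(𝔸_K^∞)/U, k)`, realised as the `k`-dual of the permutation
module `k[GL_n(𝔸_K^∞)/U]` (`MonoidAlgebra k (G ⧸ U)`, as in `heckeAlgebra`). [folklore] -/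
abbrev levelModule : Type := Module.Dual k (MonoidAlgebra k (FiniteAdelicGL n K ⧸ U))

/-- `Fun(GL_n(𝔸_K^∞)/U, k)` as a representation of `Γ = GL_n(K)`: the dual of the permutation
representation (`(γ f)(xU) = f(γ⁻¹xU)`), restricted along the diagonal embedding. By Shapiro's
lemma `H^i(Γ, -)` of it is `⊕_j H^i(Γ ∩ g_j U g_j⁻¹, k)`, the cohomology of Scholze's stacky
`X_U` [cite: Scholze2015, §V.4 (definition of X_K)]. -/
def levelRep : Representation k (GL (Fin n) K) (levelModule U k) :=
  (Representation.ofMulAction k (FiniteAdelicGL n K) (FiniteAdelicGL n K ⧸ U)).dual.comp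
    (globalEmbedding n K)

/-- Unfolding lemma for `levelRep`. [folklore] -/
theorem levelRep_apply (γ : GL (Fin n) K) (f : levelModule U k) :
    levelRep U k γ f = f ∘ₗ Representation.ofMulAction k (FiniteAdelicGL n K)
      (FiniteAdelicGL n K ⧸ U) (globalEmbedding n K γ)⁻¹ := rfl

/-- `H^i(X_U, k) := H^i(GL_n(K), Fun(GL_n(𝔸_K^∞)/U, k))` (Mathlib `groupCohomology`), the
cohomology of the stacky arithmetic quotient of level `U` [cite: Scholze2015, §V.4]. -/
def levelCohomology (i : ℕ) : ModuleCat k := groupCohomology (Rep.of (levelRep U k)) i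

variable [IsHeckeTriple (⊤ : Submonoid (FiniteAdelicGL n K)) U U]

/-- The Hecke correspondence `[UgU]` on `Fun(GL_n(𝔸_K^∞)/U, k)`: the transpose of the double-coset
operator `heckeAlgebra.doubleCosetOperator U g ∈ End_G(k[G/U])`, i.e.
`(T f)(xU) = ∑_{yU ⊆ UgU} f(x y U)` [cite: GeeNewton2020, §2.1.1]. -/
def heckeEnd (g : FiniteAdelicGL n K) : Module.End k (levelModule U k) :=
  ((heckeAlgebra.doubleCosetOperator U g : heckeAlgebra k (FiniteAdelicGL n K) U) :
      Module.End k (MonoidAlgebra k (FiniteAdelicGL n K ⧸ U))).dualMap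

/-- Unfolding lemma for `heckeEnd`. [folklore] -/
theorem heckeEnd_apply (g : FiniteAdelicGL n K) (f : levelModule U k) :
    heckeEnd U k g f = f ∘ₗ ((heckeAlgebra.doubleCosetOperator U g :
      heckeAlgebra k (FiniteAdelicGL n K) U) :
        Module.End k (MonoidAlgebra k (FiniteAdelicGL n K ⧸ U))) :=
  rfl

/-- `[UgU]` commutes with the `Γ`-action (left and right translations commute: the double-coset
operator lies in the commutant of the permutation representation). [folklore] -/
theorem heckeEnd_levelRep (g : FiniteAdelicGL n K) (γ : GL (Fin n) K) (f : levelModule U k) :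
    heckeEnd U k g (levelRep U k γ f) = levelRep U k γ (heckeEnd U k g f) := by
  have hT := (mem_heckeAlgebra_iff _).1
    (heckeAlgebra.doubleCosetOperator (k := k) U g).2 (globalEmbedding n K γ)⁻¹
  rw [Module.End.mul_eq_comp, Module.End.mul_eq_comp] at hT
  rw [heckeEnd_apply, levelRep_apply, levelRep_apply, heckeEnd_apply, LinearMap.comp_assoc,
    LinearMap.comp_assoc, hT]

/-- `[UgU]` as an endomorphism of the `Γ`-representation `Fun(GL_n(𝔸_K^∞)/U, k)`. [folklore] -/
def heckeIntertwining (g : FiniteAdelicGL n K) : (levelRep U k).IntertwiningMap (levelRep U k) :=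
  LinearMap.intertwiningMap_of_isIntertwiningMap (levelRep U k) (levelRep U k) (heckeEnd U k g)
    fun γ f => heckeEnd_levelRep U k g γ f

/-- The **Hecke operator `[UgU]` on `H^i(X_U, k)`**: functoriality of group cohomology
(`groupCohomology.functor`) applied to `heckeIntertwining` [cite: GeeNewton2020, §2.1.1]. -/
def heckeOnCohomology (g : FiniteAdelicGL n K) (i : ℕ) : Module.End k (levelCohomology U k i) :=
  ((groupCohomology.functor k (GL (Fin n) K) i).map (Rep.ofHom (heckeIntertwining U k g))).hom

end Level

/-! ### `S`-good level data and the `p`-power tower -/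

variable (K) in
/-- There are finitely many places of `K` above the rational prime `p` (`Ideal.finite_factors`).
[folklore] -/
theorem finite_setOf_natCast_mem_asIdeal (p : ℕ) [Fact p.Prime] :
    {v : HeightOneSpectrum (𝓞 K) | (p : 𝓞 K) ∈ v.asIdeal}.Finite := by
  have hp : (Ideal.span {(p : 𝓞 K)} : Ideal (𝓞 K)) ≠ 0 := by
    rw [Ne, Ideal.zero_eq_bot, Ideal.span_singleton_eq_bot]
    exact_mod_cast (Fact.out : p.Prime).ne_zero
  refine (Ideal.finite_factors hp).subset fun v hv => ?_
  exact (Ideal.dvd_span_singleton).2 hv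

variable (n K)

/-- An **`S`-good (tame) level datum** for `GL_n/K` at `p`: an open compact subgroup
`U ≤ GL_n(𝒪̂_K) ≤ GL_n(𝔸_K^∞)` and a finite set `S = bad` of finite places containing every
`v ∣ p`, such that for `v ∉ S` the group `U` contains `GL_n(𝒪_v)` (embedded at `v`) and is stable
under deleting the `v`-component — i.e. `U = U_S · ∏_{v ∉ S} GL_n(𝒪_v)`, Scholze's
`K = K_S K^S ⊂ ∏_v GL_n(𝒪_{F_v})` [cite: Scholze2015, Thm. V.4.1 (hypotheses)],
Gee–Newton's "`S`-good" [cite: GeeNewton2020, §2.1]. The level at `p` is shrunk by `tower`. -/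
structure TameLevel (p : ℕ) [Fact p.Prime] where
  /-- The level subgroup `U ≤ GL_n(𝔸_K^∞)`. -/
  subgroup : Subgroup (FiniteAdelicGL n K)
  /-- The finite set `S` of bad finite places. -/
  bad : Set (HeightOneSpectrum (𝓞 K))
  bad_finite : bad.Finite
  /-- Every place above `p` is bad. -/
  mem_bad_of_mem : ∀ v : HeightOneSpectrum (𝓞 K), (p : 𝓞 K) ∈ v.asIdeal → v ∈ bad
  isOpen : IsOpen (subgroup : Set (FiniteAdelicGL n K))
  isCompact : IsCompact (subgroup : Set (FiniteAdelicGL n K))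
  /-- `U ≤ GL_n(𝒪̂_K)`. -/
  le_glFiniteIntegralLevel : subgroup ≤ glFiniteIntegralLevel n K
  /-- `U` is hyperspecial at `v ∉ S`: it contains `GL_n(𝒪_v)` embedded at `v`. -/
  ofLocal_mem : ∀ v ∉ bad, ∀ g ∈ valuedCongruenceSubgroup (Fin n) (1 : WithZero (Multiplicative ℤ)),
    ofLocal n K v g ∈ subgroup
  /-- `U` is factorizable at `v ∉ S`: deleting the `v`-component of `u ∈ U` stays in `U`. -/
  mul_ofLocal_inv_mem : ∀ v ∉ bad, ∀ u ∈ subgroup,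
    u * (ofLocal n K v (localComponent n K v u))⁻¹ ∈ subgroup

variable {n K} {p : ℕ} [Fact p.Prime] (𝒰 : TameLevel n K p)

namespace TameLevel

/-- The **level `U_r`** of the `p`-power tower: `u ∈ U` with `u_v ≡ 1 (mod ϖ_v^r)` for every
`v ∣ p` — `u_v` in the principal congruence subgroup `K_v(ϖ_v^r) = 1 + ϖ_v^r M_n(𝒪_v)`, i.e. the
valued congruence subgroup `valuedCongruenceSubgroup (Fin n) |ϖ_v|^r` of `GLnAdelicStructure`
(radius `WithZero.exp (-r)`; this is `localCongruenceSubgroup n K v r` of `GLnCuspidalSpectrumProofs`,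
definitionally — see "Import discipline" in the module docstring), pulled back along
`localComponent`; `U_0 = U` (as `U ≤ GL_n(𝒪̂_K)`), and the `U_r` are cofinal among the open
subgroups of `U` obtained by shrinking at `p` only
[cite: CalegariEmerton2011, §1.1 and §2 (the tower X_r)]. -/
def tower (r : ℕ) : Subgroup (FiniteAdelicGL n K) :=
  𝒰.subgroup ⊓ ⨅ v : {v : HeightOneSpectrum (𝓞 K) // (p : 𝓞 K) ∈ v.asIdeal},
    (valuedCongruenceSubgroup (Fin n) (WithZero.exp (-(r : ℤ)) : WithZero (Multiplicative ℤ)) :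
      Subgroup (GL (Fin n) (v.1.adicCompletion K))).comap (localComponent n K v.1)

/-- `U_r ≤ U`. [folklore] -/
theorem tower_le (r : ℕ) : 𝒰.tower r ≤ 𝒰.subgroup := inf_le_left

/-- The `U_r` decrease (`|ϖ_v|^{r'} ≤ |ϖ_v|^r` for `r ≤ r'`, `valuedCongruenceSubgroup_mono`).
[folklore] -/
theorem tower_antitone : Antitone 𝒰.tower := fun _ _ h =>
  inf_le_inf_left _ (iInf_mono fun _ => Subgroup.comap_mono (valuedCongruenceSubgroup_mono (Fin n)
    (WithZero.exp_le_exp.2 (neg_le_neg (Int.ofNat_le.2 h)))))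

omit [Fact p.Prime] 𝒰 in
/-- The principal congruence subgroups `K_v(c) = valuedCongruenceSubgroup (Fin n) c`, `c ≠ 0`, are
open in `GL_n(K_v)`: finitely many conditions `|g_{ij}|_v ≤ 1`, `|(g⁻¹)_{ij}|_v ≤ 1`,
`|(g - 1)_{ij}|_v ≤ c`, each the preimage of a closed ball of nonzero radius — open, Mathlib
`Valued.isOpen_closedBall` — under a continuous map (Bushnell–Henniart §1.1). Re-derived here in a
few lines (it is `isOpen_valuedCongruenceSubgroup` of `GLnCuspidalSpectrumProofs`) to keep this
vocabulary file out of that file's import cone; see "Import discipline". [folklore] -/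
private theorem isOpen_valuedCongruenceSubgroup_aux (v : HeightOneSpectrum (𝓞 K))
    {c : WithZero (Multiplicative ℤ)} (hc : c ≠ 0) :
    IsOpen ((valuedCongruenceSubgroup (Fin n) c : Subgroup (GL (Fin n) (v.adicCompletion K))) :
      Set (GL (Fin n) (v.adicCompletion K))) := by
  -- closed balls of nonzero radius in `K_v` are open
  have hball : ∀ {r : WithZero (Multiplicative ℤ)}, r ≠ 0 →
      IsOpen {y : v.adicCompletion K | Valued.v y ≤ r} := by
    intro r hr
    obtain ⟨z, hz⟩ := v.valuation_surjective K r
    have hz' : Valued.v (z : v.adicCompletion K) = r := by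
      rw [HeightOneSpectrum.valuedAdicCompletion_eq_valuation', hz]
    have hne : Valued.v.restrict (z : v.adicCompletion K) ≠ 0 := by
      rw [Ne, Valuation.restrict_eq_zero_iff, hz']
      exact hr
    have h := Valued.isOpen_closedBall (v.adicCompletion K) hne
    simp only [Valuation.restrict_le_iff, hz'] at h
    exact h
  have hval : Continuous fun g : GL (Fin n) (v.adicCompletion K) =>
      (g : Matrix (Fin n) (Fin n) (v.adicCompletion K)) := Units.continuous_val
  have hinv : Continuous fun g : GL (Fin n) (v.adicCompletion K) =>
      ((g⁻¹ : GL (Fin n) (v.adicCompletion K)) : Matrix (Fin n) (Fin n) (v.adicCompletion K)) :=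
    Units.continuous_coe_inv
  have hset : ((valuedCongruenceSubgroup (Fin n) c : Subgroup (GL (Fin n) (v.adicCompletion K))) :
      Set (GL (Fin n) (v.adicCompletion K))) =
      ((⋂ i, ⋂ j, {g : GL (Fin n) (v.adicCompletion K) |
          Valued.v ((g : Matrix (Fin n) (Fin n) (v.adicCompletion K)) i j) ≤ 1}) ∩
        ⋂ i, ⋂ j, {g : GL (Fin n) (v.adicCompletion K) |
          Valued.v (((g⁻¹ : GL (Fin n) (v.adicCompletion K)) :
            Matrix (Fin n) (Fin n) (v.adicCompletion K)) i j) ≤ 1}) ∩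
        ⋂ i, ⋂ j, {g : GL (Fin n) (v.adicCompletion K) |
          Valued.v (((g : Matrix (Fin n) (Fin n) (v.adicCompletion K)) - 1) i j) ≤ c} := by
    ext g
    simp only [SetLike.mem_coe, mem_valuedCongruenceSubgroup_iff, Set.mem_inter_iff,
      Set.mem_iInter, Set.mem_setOf_eq, and_assoc]
  rw [hset]
  exact ((isOpen_iInter_of_finite fun i => isOpen_iInter_of_finite fun j =>
      (hball one_ne_zero).preimage (hval.matrix_elem i j)).inter
    (isOpen_iInter_of_finite fun i => isOpen_iInter_of_finite fun j =>
      (hball one_ne_zero).preimage (hinv.matrix_elem i j))).inter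
    (isOpen_iInter_of_finite fun i => isOpen_iInter_of_finite fun j =>
      (hball hc).preimage ((hval.sub continuous_const).matrix_elem i j))

/-- `U_r` is open (finite intersection of open subgroups). [folklore] -/
theorem isOpen_tower (r : ℕ) : IsOpen (𝒰.tower r : Set (FiniteAdelicGL n K)) := by
  rw [tower, Subgroup.coe_inf, Subgroup.coe_iInf]
  haveI : Finite {v : HeightOneSpectrum (𝓞 K) // (p : 𝓞 K) ∈ v.asIdeal} :=
    finite_setOf_natCast_mem_asIdeal K p
  refine 𝒰.isOpen.inter (isOpen_iInter_of_finite fun v => ?_)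
  rw [Subgroup.coe_comap]
  exact (isOpen_valuedCongruenceSubgroup_aux v.1 WithZero.coe_ne_zero).preimage
    (continuous_localComponent n K _)

/-- `U_r` is compact (closed in the compact `U`). [folklore] -/
theorem isCompact_tower (r : ℕ) : IsCompact (𝒰.tower r : Set (FiniteAdelicGL n K)) := by
  rw [tower, Subgroup.coe_inf, Subgroup.coe_iInf]
  refine 𝒰.isCompact.of_isClosed_subset ((Subgroup.isClosed_of_isOpen _ 𝒰.isOpen).inter
    (isClosed_iInter fun v => ?_)) Set.inter_subset_left
  rw [Subgroup.coe_comap]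
  exact (Subgroup.isClosed_of_isOpen _
    (isOpen_valuedCongruenceSubgroup_aux v.1 WithZero.coe_ne_zero)).preimage
    (continuous_localComponent n K _)

/-- `U_r` is a Hecke subgroup of `GL_n(𝔸_K^∞)` (compact open, `isHeckeTriple_top_of_isCompact_isOpen`).
[folklore] -/
instance isHeckeTriple_tower (r : ℕ) :
    IsHeckeTriple (⊤ : Submonoid (FiniteAdelicGL n K)) (𝒰.tower r) (𝒰.tower r) :=
  isHeckeTriple_top_of_isCompact_isOpen _ (𝒰.isCompact_tower r) (𝒰.isOpen_tower r)

/-! ### The product of the finite-level endomorphism rings and `𝕋(K^p)` -/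

/-- The factor `End_{ℤ/p^s}(H^i(X_{U_r}, ℤ/p^s))` at the index `(r, s, i)`, a ring carrying the
DISCRETE topology. [folklore] -/
def EndFactor (idx : ℕ × ℕ × ℕ) : Type :=
  Module.End (ZMod (p ^ idx.2.1)) (levelCohomology (𝒰.tower idx.1) (ZMod (p ^ idx.2.1)) idx.2.2)

/-- Ring structure of the factor (that of `Module.End`). [folklore] -/
instance (idx : ℕ × ℕ × ℕ) : Ring (𝒰.EndFactor idx) := inferInstanceAs (Ring (Module.End _ _))

/-- The discrete topology on each factor. [folklore] -/
instance (idx : ℕ × ℕ × ℕ) : TopologicalSpace (𝒰.EndFactor idx) := ⊥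

/-- Each factor is discrete (by definition). [folklore] -/
instance (idx : ℕ × ℕ × ℕ) : DiscreteTopology (𝒰.EndFactor idx) := ⟨rfl⟩

/-- The product topological ring `∏_{(r,s,i)} End(H^i(X_{U_r}, ℤ/p^s))` (product topology of
discrete rings: Hausdorff, a topological ring). [folklore] -/
abbrev bigEnd : Type := ∀ idx : ℕ × ℕ × ℕ, 𝒰.EndFactor idx

/-- The family `([U_r g U_r] on H^i(X_{U_r}, ℤ/p^s))_{(r,s,i)}` of Hecke operators of
`g ∈ GL_n(𝔸_K^∞)`, an element of the product ring. [folklore] -/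
def heckeOperator (g : FiniteAdelicGL n K) : 𝒰.bigEnd := fun idx =>
  show 𝒰.EndFactor idx from heckeOnCohomology (𝒰.tower idx.1) (ZMod (p ^ idx.2.1)) g idx.2.2

/-- The generators of the abstract spherical Hecke algebra `𝕋^S = ⊗_{v ∉ S} ℤ[GL_n(K_v)//GL_n(𝒪_v)]`,
acting on the tower: the `T_{v,i}` (`i ≥ 0`; `i ≥ n` all give `T_{v,n}`) and the operator of the
central element `t_{v,n}⁻¹` (an inverse of `T_{v,n}`), for `v ∉ S`
[cite: Scholze2015, §V.4 (𝕋_{F,S})] [cite: GeeNewton2020, §2.1.3]. -/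
def heckeGenerators : Set 𝒰.bigEnd :=
  {T | ∃ v ∉ 𝒰.bad, ∃ i : ℕ, T = 𝒰.heckeOperator (heckeElement n K v i)} ∪
    {T | ∃ v ∉ 𝒰.bad, T = 𝒰.heckeOperator ((heckeElement n K v n)⁻¹)}

/-- The big Hecke algebra as a CLOSED SUBRING of the product: the topological closure of the
subring generated by `heckeGenerators` — the inverse limit, over finite sets `J` of indices
`(r,s,i)`, of the images of `𝕋^S` in `End(⊕_{J} H^i(X_{U_r}, ℤ/p^s))`
[cite: GeeNewton2020, §2.1.3, Def. 2.1.5] [cite: Scholze2015, Rem. V.4.5]. -/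
def bigHeckeSubring : Subring 𝒰.bigEnd :=
  (Subring.closure 𝒰.heckeGenerators).topologicalClosure

end TameLevel

end BigHeckeGLn

open BigHeckeGLn

/-- **The completed-cohomology (big) Hecke algebra `𝕋(K^p)` of `GL_n/K` of tame level `𝒰`**:
the closed subring of `∏_{(r,s,i)} End(H^i(X_{U_r}, ℤ/p^s))` topologically generated by the
spherical Hecke operators `T_{v,i}`, `T_{v,n}⁻¹` at the good places `v ∉ S` — a Hausdorff
topological ring (`TameLevel.bigHeckeSubring`); `𝕋^S(U^p) = lim_{U_p,s} 𝕋^S(U_pU^p, s)` of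
[cite: GeeNewton2020, §2.1.3, Def. 2.1.5 and Rem. 2.1.7], the completed Hecke algebra `𝕋` of
[cite: CalegariEmerton2011, §2] (closure of the image of Emerton's spherical Hecke algebra
`ℋ(K^p)^{sph}`, [cite: Emerton2006, §2.3]), Scholze's `𝕋_{F,S}(K)` at finite level
[cite: Scholze2015, Rem. V.4.5]. Commutativity is the named fact
`TameLevel.heckeGenerators_commute`; semi-locality and `𝔪`-adic completeness
[cite: GeeNewton2020, Lemma 2.1.8] are not formalised. -/
abbrev CompletedCohomologyHeckeAlgebraGLn {n : ℕ} {K : Type} [Field K] [NumberField K] {p : ℕ}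
    [Fact p.Prime] (𝒰 : TameLevel n K p) : Type :=
  𝒰.bigHeckeSubring

namespace BigHeckeGLn

/-! ### The Hecke–Frobenius polynomial and association -/

open Polynomial in
/-- The **Hecke–Frobenius polynomial**
`P(X) = X^n − a₁ X^{n−1} + … + (−1)^i q^{i(i−1)/2} a_i X^{n−i} + … + (−1)^n q^{n(n−1)/2} a_n`
of an eigensystem `a` (`a_i =` eigenvalue/image of `T_{v,i}`) at a place with residue field of size
`q` [cite: GeeNewton2020, §3.3, Conj. 3.3.2] (monic form of `det(1 − Xρ(Frob_v))` in
[cite: HansenUniversalEigenvarieties2017, Def. 1.2.1]); `a 0` is not used. -/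
def heckeFrobPoly (n : ℕ) {A : Type*} [Ring A] (q : ℕ) (a : ℕ → A) : Polynomial A :=
  X ^ n + ∑ i ∈ Finset.Icc 1 n, C ((-1 : A) ^ i * (q : A) ^ (i * (i - 1) / 2) * a i) * X ^ (n - i)

/-- `ρ : Γ_K → GL_n(A)` is **associated** with the eigensystem family `a` outside `S`: for every
finite place `v ∉ S`, `ρ` is unramified at `v` and every arithmetic Frobenius at `v` has
characteristic polynomial `heckeFrobPoly n q_v (a v)`, `q_v = Nm v`
[cite: GeeNewton2020, §3.3, Conj. 3.3.2] [cite: HansenUniversalEigenvarieties2017, Def. 1.2.1].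
(Tree convention: `FramedGaloisRep.HasFrobCharpolyAt`, arithmetic Frobenius; see the module
docstring for the dictionary with geometric-Frobenius sources.) -/
def IsAssociatedFamily (n : ℕ) {K : Type} [Field K] [NumberField K]
    (S : Set (HeightOneSpectrum (𝓞 K))) {A : Type*} [CommRing A] [TopologicalSpace A]
    (a : HeightOneSpectrum (𝓞 K) → ℕ → A)
    (ρ : Literature.NumberTheory.GaloisRepresentations.FramedGaloisRep K A n) : Prop :=
  ∀ v ∉ S, ρ.IsUnramifiedAt v ∧
    ρ.HasFrobCharpolyAt v (heckeFrobPoly n (Ideal.absNorm v.asIdeal) (a v))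

namespace TameLevel

variable {n : ℕ} {K : Type} [Field K] [NumberField K] {p : ℕ} [Fact p.Prime]
  (𝒰 : TameLevel n K p)

/-- For `v ∉ S` every `T_{v,i}` lies in `𝕋(K^p)`. [folklore] -/
theorem heckeOperator_mem {v : HeightOneSpectrum (𝓞 K)} (hv : v ∉ 𝒰.bad) (i : ℕ) :
    𝒰.heckeOperator (heckeElement n K v i) ∈ 𝒰.bigHeckeSubring :=
  (Subring.closure 𝒰.heckeGenerators).le_topologicalClosure
    (Subring.subset_closure (Or.inl ⟨v, hv, i, rfl⟩))

open scoped Classical in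
/-- The **Hecke operator `T_{v,i} ∈ 𝕋(K^p)`** for `v ∉ S` (junk value `0` for `v ∈ S`)
[cite: GeeNewton2020, §2.1.1]. -/
def heckeT (v : HeightOneSpectrum (𝓞 K)) (i : ℕ) : CompletedCohomologyHeckeAlgebraGLn 𝒰 :=
  if hv : v ∈ 𝒰.bad then 0 else ⟨𝒰.heckeOperator (heckeElement n K v i), 𝒰.heckeOperator_mem hv i⟩

/-- Unfolding lemma: for `v ∉ S`, `heckeT 𝒰 v i` is the family of operators `[U_r t_{v,i} U_r]`.
[folklore] -/
theorem coe_heckeT {v : HeightOneSpectrum (𝓞 K)} (hv : v ∉ 𝒰.bad) (i : ℕ) :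
    (𝒰.heckeT v i : 𝒰.bigEnd) = 𝒰.heckeOperator (heckeElement n K v i) := by
  classical
  rw [heckeT, dif_neg hv]

/-- `ρ` and the `A`-valued eigensystem `x : 𝕋(K^p) → A` are **associated**: `ρ` is unramified at
all `v ∉ S` with `charpoly ρ(Frob_v) = x(P_v)`, `P_v = heckeFrobPoly n q_v (T_{v,·})`
[cite: GeeNewton2020, §3.3, Conj. 3.3.2] [cite: HansenUniversalEigenvarieties2017, Def. 1.2.1]. -/
def IsAssociated {A : Type*} [CommRing A] [TopologicalSpace A]
    (x : CompletedCohomologyHeckeAlgebraGLn 𝒰 →+* A)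
    (ρ : Literature.NumberTheory.GaloisRepresentations.FramedGaloisRep K A n) : Prop :=
  IsAssociatedFamily n 𝒰.bad (fun v i => x (𝒰.heckeT v i)) ρ

/-- **`ρ` is `𝔭`-adically automorphic ("pro-automorphic", "pro-modular") of tame level `𝒰`**
with coefficients in the topological ring `A` (intended: `A = 𝒪_E`, `E/ℚ_p` finite, `ℤ̄_p`,
`ℚ̄_p = PadicAlgCl p`): `ρ` is associated with a CONTINUOUS `A`-valued point of `𝕋(K^p)`, i.e.
with an eigensystem that is a `p`-adic limit of Hecke eigensystems occurring in
`H^•(X_{U_r}, ℤ/p^s)` — [cite: HansenUniversalEigenvarieties2017, Def. 1.2.1 and Conj. 1.2.3]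
with the completed-cohomology Hecke algebra in place of the eigenvariety, cf.
[cite: GeeNewton2020, §3.3, Def. 3.3.4] (points of `𝕋^S(U^p)_𝔪`). -/
def IsPadicallyAutomorphic {A : Type*} [CommRing A] [TopologicalSpace A]
    (ρ : Literature.NumberTheory.GaloisRepresentations.FramedGaloisRep K A n) : Prop :=
  ∃ x : CompletedCohomologyHeckeAlgebraGLn 𝒰 →+* A, Continuous x ∧ 𝒰.IsAssociated x ρ

/-- `x : 𝕋(K^p) → A` (`A` local) is a **point of `Spf 𝕋(K^p)_𝔪`**: `x` is continuous and
`x⁻¹(𝔪_A) = 𝔪` (so `x` factors through the complete local ring `𝕋(K^p)_𝔪` of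
[cite: GeeNewton2020, §2.1.3, Lemma 2.1.8]). -/
def IsPointOver (𝔪 : Ideal (CompletedCohomologyHeckeAlgebraGLn 𝒰)) {A : Type*} [CommRing A]
    [TopologicalSpace A] [IsLocalRing A] (x : CompletedCohomologyHeckeAlgebraGLn 𝒰 →+* A) : Prop :=
  Continuous x ∧ Ideal.comap x (IsLocalRing.maximalIdeal A) = 𝔪

/-- `ρ̄` is a **residual Galois representation at `𝔪`** (a `ρ̄_𝔪`): `𝔪 = ker ψ` for a continuous
eigensystem `ψ : 𝕋(K^p) → k` into a (discrete) field, and `ρ̄` is associated with `ψ`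
[cite: GeeNewton2020, §3.3, Conj. 3.3.2 (1)]. Unique up to semisimplification (Brauer–Nesbitt). -/
def IsResidualRepAt (𝔪 : Ideal (CompletedCohomologyHeckeAlgebraGLn 𝒰)) {k : Type*} [Field k]
    [TopologicalSpace k] (ψ : CompletedCohomologyHeckeAlgebraGLn 𝒰 →+* k)
    (ρ : Literature.NumberTheory.GaloisRepresentations.FramedGaloisRep K k n) : Prop :=
  Continuous ψ ∧ RingHom.ker ψ = 𝔪 ∧ 𝒰.IsAssociated ψ ρ

/-- The ideal `𝔪 ⊂ 𝕋(K^p)` is **non-Eisenstein**: `𝔪` is "of Galois type" (it has a residual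
representation `ρ̄_𝔪` over a discrete field) and `ρ̄_𝔪` is absolutely irreducible (equivalently,
by Brauer–Nesbitt, every residual representation at `𝔪` is)
[cite: AllenCalegariCaraianiGeeEtAl2023, §2.3.2, Definition (Galois type; non-Eisenstein)]
[cite: GeeNewton2020, §3.3, standing hypotheses after Def. 3.3.4]. -/
def IsNonEisenstein (𝔪 : Ideal (CompletedCohomologyHeckeAlgebraGLn 𝒰)) : Prop :=
  ∃ (k : Type) (_ : Field k) (_ : TopologicalSpace k) (_ : DiscreteTopology k)
    (ψ : CompletedCohomologyHeckeAlgebraGLn 𝒰 →+* k)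
    (ρ : Literature.NumberTheory.GaloisRepresentations.FramedGaloisRep K k n),
    𝒰.IsResidualRepAt 𝔪 ψ ρ ∧
      Literature.NumberTheory.GaloisRepresentations.FramedRep.IsAbsolutelyIrreducible ρ

/-! ### Commutativity (named fact), localisation `𝕋(K^p)_𝔪`, the big Galois representation -/

/-- **Named fact: the spherical Hecke operators commute.** The operators `T_{v,i}` (and the
operators of `t_{v,n}⁻¹`), `v ∉ S`, pairwise commute on every `H^i(X_{U_r}, ℤ/p^s)`: the
spherical Hecke algebras `ℤ[GL_n(K_v)//GL_n(𝒪_v)]` are commutative (Gelfand pairs, Satake;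
cf. `IsGelfandPair`) and act, compatibly for different `v`, through the commutative
`𝕋^S = ⊗_{v∉S}` [cite: GeeNewton2020, §2.1.1 ("these operators … pairwise commute")]
[cite: Cartier1979, §IV.1]. -/
def heckeGenerators_commute : Prop :=
  ∀ a ∈ 𝒰.heckeGenerators, ∀ b ∈ 𝒰.heckeGenerators, a * b = b * a

/-- Granted `heckeGenerators_commute`, `𝕋(K^p)` is commutative (closure and topological closure of
a commuting set, `Subring.commRingTopologicalClosure`). [folklore] -/
theorem mul_comm_of_heckeGenerators_commute (h : 𝒰.heckeGenerators_commute)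
    (a b : CompletedCohomologyHeckeAlgebraGLn 𝒰) : a * b = b * a := by
  have hcl : ∀ x y : Subring.closure 𝒰.heckeGenerators, x * y = y * x := by
    intro x y
    have hx := Subring.closure_le_centralizer_centralizer 𝒰.heckeGenerators x.2
    have hy : (y : 𝒰.bigEnd) ∈
        Subring.centralizer (Subring.centralizer 𝒰.heckeGenerators : Set _) :=
      Subring.closure_le_centralizer_centralizer 𝒰.heckeGenerators y.2
    have hsub : (Subring.centralizer (Subring.centralizer 𝒰.heckeGenerators : Set 𝒰.bigEnd) :
        Set 𝒰.bigEnd) ⊆ Subring.centralizer 𝒰.heckeGenerators :=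
      Set.centralizer_subset fun a ha => Subring.mem_centralizer_iff.2 fun b hb => h b hb a ha
    exact Subtype.ext (Subring.mem_centralizer_iff.1 hy x (hsub hx))
  letI : CommRing (CompletedCohomologyHeckeAlgebraGLn 𝒰) :=
    (Subring.closure 𝒰.heckeGenerators).commRingTopologicalClosure hcl
  exact mul_comm a b

/-- The commutative-ring structure on `𝕋(K^p)` (same operations) granted the named fact
`heckeGenerators_commute`. [folklore] -/
abbrev commRing (h : 𝒰.heckeGenerators_commute) :
    CommRing (CompletedCohomologyHeckeAlgebraGLn 𝒰) :=
  { (inferInstance : Ring (CompletedCohomologyHeckeAlgebraGLn 𝒰)) with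
    mul_comm := 𝒰.mul_comm_of_heckeGenerators_commute h }

/-- **`𝕋(K^p)_𝔪`**, the localisation of the big Hecke algebra at a maximal ideal `𝔪` (Mathlib
`Localization.AtPrime`, with its coinduced ring topology `Localization.ringTopology`)
[cite: GeeNewton2020, §2.1.3, Lemma 2.1.8] [cite: Scholze2015, Cor. V.4.4]. -/
def Localized (h : 𝒰.heckeGenerators_commute) (𝔪 : Ideal (CompletedCohomologyHeckeAlgebraGLn 𝒰))
    [𝔪.IsMaximal] : Type :=
  letI := 𝒰.commRing h
  Localization.AtPrime 𝔪

namespace Localized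

variable (h : 𝒰.heckeGenerators_commute) (𝔪 : Ideal (CompletedCohomologyHeckeAlgebraGLn 𝒰))
  [𝔪.IsMaximal]

/-- Ring structure of `𝕋(K^p)_𝔪` (Mathlib's on the localisation). [folklore] -/
instance : CommRing (Localized 𝒰 h 𝔪) := by
  letI := 𝒰.commRing h; exact inferInstanceAs (CommRing (Localization.AtPrime 𝔪))

/-- Topology of `𝕋(K^p)_𝔪`: the ring topology coinduced from `𝕋(K^p)`
(`Localization.ringTopology`). [folklore] -/
instance : TopologicalSpace (Localized 𝒰 h 𝔪) := by
  letI := 𝒰.commRing h; exact inferInstanceAs (TopologicalSpace (Localization.AtPrime 𝔪))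

/-- `𝕋(K^p)_𝔪` is a topological ring. [folklore] -/
instance : IsTopologicalRing (Localized 𝒰 h 𝔪) := by
  letI := 𝒰.commRing h; exact inferInstanceAs (IsTopologicalRing (Localization.AtPrime 𝔪))

/-- `𝕋(K^p)_𝔪` is a local ring. [folklore] -/
instance : IsLocalRing (Localized 𝒰 h 𝔪) := by
  letI := 𝒰.commRing h; exact inferInstanceAs (IsLocalRing (Localization.AtPrime 𝔪))

/-- The localisation map `𝕋(K^p) →+* 𝕋(K^p)_𝔪`. [folklore] -/
def of : CompletedCohomologyHeckeAlgebraGLn 𝒰 →+* Localized 𝒰 h 𝔪 := by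
  letI := 𝒰.commRing h
  exact algebraMap (CompletedCohomologyHeckeAlgebraGLn 𝒰) (Localization.AtPrime 𝔪)

/-- The localisation map is continuous (by construction of the coinduced topology). [folklore] -/
theorem continuous_of : Continuous (of 𝒰 h 𝔪) := by
  letI := 𝒰.commRing h
  exact RingTopology.coinduced_continuous (Localization.monoidOf 𝔪.primeCompl).toFun

end Localized

/-- **Hypothesis structure: the big Galois representation at `𝔪`.** A continuous
`ρ_𝔪 : Γ_K → GL_n(𝕋(K^p)_𝔪)` whose Frobenius characteristic polynomials at `v ∉ S` are the
Hecke–Frobenius polynomials `P_v ∈ 𝕋(K^p)_𝔪[X]` — the datum of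
[cite: GeeNewton2020, §3.3, Conj. 3.3.2 (2)] (cf. [cite: CalegariGeraghty2017, Conj. A (§4.3 of the arXiv version: ρ_𝔪 for GL_2 over imaginary quadratic fields)])
at a non-Eisenstein `𝔪`, where determinants are true representations. Existence is NOT asserted:
on the nose it is the OPEN conjecture [cite: GeeNewton2020, §3.3, Conj. 3.3.2 (2)] (not declared in
`Literature/`, see the module docstring); modulo a nilpotent ideal it is the named fact
`bigGaloisRep_modNilpotent_exists` (theorem in print; leaf module
`CompletedCohomologyHeckeAlgebraGLnFacts`). -/
structure BigGaloisRepAt (h : 𝒰.heckeGenerators_commute)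
    (𝔪 : Ideal (CompletedCohomologyHeckeAlgebraGLn 𝒰)) [𝔪.IsMaximal] where
  /-- The representation `ρ_𝔪 : Γ_K →ₜ* GL_n(𝕋(K^p)_𝔪)`. -/
  rep : Literature.NumberTheory.GaloisRepresentations.FramedGaloisRep K (Localized 𝒰 h 𝔪) n
  /-- `charpoly ρ_𝔪(Frob_v) = P_v` and unramified, for all `v ∉ S`. -/
  isAssociated : IsAssociatedFamily n 𝒰.bad (fun v i => Localized.of 𝒰 h 𝔪 (𝒰.heckeT v i)) rep

/-! ### Finite-level Hecke algebras `𝕋(U_r, s, i)`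

The existence theorems stated in them — `TameLevel.residualRep_exists` and
`TameLevel.bigGaloisRep_modNilpotent_exists` (Scholze), named facts — live in the leaf module
`Literature.NumberTheory.Automorphic.CompletedCohomologyHeckeAlgebraGLnFacts`. -/

/-- The finite-level Hecke algebra `𝕋(U_r, s, i) = im(𝕋^S → End(H^i(X_{U_r}, ℤ/p^s)))` at the
index `idx = (r, s, i)`: the subring of the factor generated by the `idx`-components of the
generators (Scholze's `𝕋_{F,S}(K, i, m)` for `K = U_r`, `m = s`, trivial `ξ`)
[cite: Scholze2015, Thm. V.4.1 (definition of 𝕋_{F,S}(K,ξ,i,m))]. -/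
def levelHeckeSubring (idx : ℕ × ℕ × ℕ) : Subring (𝒰.EndFactor idx) :=
  Subring.closure ((fun T : 𝒰.bigEnd => T idx) '' 𝒰.heckeGenerators)

open scoped Classical in
/-- `T_{v,i}` in the finite-level Hecke algebra at `idx` (junk `0` for `v ∈ S`). [folklore] -/
def levelHeckeT (idx : ℕ × ℕ × ℕ) (v : HeightOneSpectrum (𝓞 K)) (i : ℕ) :
    𝒰.levelHeckeSubring idx :=
  if hv : v ∈ 𝒰.bad then 0 else ⟨𝒰.heckeOperator (heckeElement n K v i) idx,
    Subring.subset_closure ⟨_, Or.inl ⟨v, hv, i, rfl⟩, rfl⟩⟩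

end TameLevel

/-! ### Non-vacuity: the full level `GL_n(𝒪̂_K)` -/

section Full

variable (n : ℕ) (K : Type) [Field K] [NumberField K] (p : ℕ) [Fact p.Prime]

variable {n K} in
/-- For `u ∈ GL_n(𝒪̂_K)` every local component `u_v` lies in `GL_n(𝒪_v)` (entries of `u, u⁻¹` are
integral at `v`). [folklore] -/
theorem localComponent_mem_valuedCongruenceSubgroup_one {u : FiniteAdelicGL n K}
    (hu : u ∈ glFiniteIntegralLevel n K) (v : HeightOneSpectrum (𝓞 K)) :
    localComponent n K v u ∈
      valuedCongruenceSubgroup (Fin n) (1 : WithZero (Multiplicative ℤ)) := by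
  obtain ⟨h₁, h₂⟩ := mem_glFiniteIntegralLevel_iff.1 hu
  have h₁' : ∀ i j, Valued.v ((localComponent n K v u :
      Matrix (Fin n) (Fin n) (v.adicCompletion K)) i j) ≤ 1 := fun i j =>
    (HeightOneSpectrum.mem_adicCompletionIntegers (R := 𝓞 K) K v).mp ((h₁ i j) v)
  refine ⟨h₁', fun i j => ?_, fun i j => ?_⟩
  · rw [← map_inv]
    exact (HeightOneSpectrum.mem_adicCompletionIntegers (R := 𝓞 K) K v).mp ((h₂ i j) v)
  · rw [Matrix.sub_apply]
    refine (Valued.v.map_sub _ _).trans (max_le (h₁' i j) ?_)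
    rw [Matrix.one_apply]
    split_ifs <;> simp

/-- **The full tame level**: `U = GL_n(𝒪̂_K)` (`glFiniteIntegralLevel`, open and — by the proved
`isCompact_glFiniteIntegralLevel_holds` — compact) with `S = {v ∣ p}`. A non-vacuity witness for
`TameLevel` (e.g. `TameLevel.full 3 ℚ 7`). [folklore] -/
def TameLevel.full : TameLevel n K p where
  subgroup := glFiniteIntegralLevel n K
  bad := {v | (p : 𝓞 K) ∈ v.asIdeal}
  bad_finite := finite_setOf_natCast_mem_asIdeal K p
  mem_bad_of_mem _ hv := hv
  isOpen := isOpen_glFiniteIntegralLevel n K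
  isCompact := isCompact_glFiniteIntegralLevel_holds n K
  le_glFiniteIntegralLevel := le_rfl
  ofLocal_mem v _ g hg :=
    (mem_glIntegralLevel_iff.1 (isMaximalAt_glIntegralLevel n K v ⟨g, hg, rfl⟩)).1
  mul_ofLocal_inv_mem v _ _ hu := mul_mem hu (inv_mem (mem_glIntegralLevel_iff.1
    (isMaximalAt_glIntegralLevel n K v
      ⟨_, localComponent_mem_valuedCongruenceSubgroup_one hu v, rfl⟩)).1)

end Full

end BigHeckeGLn

end Literature.NumberTheory.Automorphic
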